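import Summits.CriticalPhenomena.PercolationContinuityZ3.Theses.PercLongRangeCatalyst
import Summits.CriticalPhenomena.PercolationContinuityZ3.Theorems.PercLongRangeCatalystSubcritCatalystStabilityBounds
import Literature.Probability.Percolation.InfraredBoundTriangle
import Literature.Probability.Percolation.NonBacktrackingPathCounting
import Literature.Probability.LatticeModels.MagnetizationExponentUpper
import HarnessLib

/-!
# `PercLongRangeCatalyst.SubcritCatalystStability` (stmt-CriticalPhenomena-4824): the catalyst is free below `p_c(ℤ³)`

RSW3 lane (lead, gen 31).  CLOSES item `stmt-CriticalPhenomena-4824` of route `CriticalPhenomena/PercLongRangeCatalyst`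
(support): for every `α > 0` and every `p < p_c(ℤ³)` there are `b > 0` and `λ ∈ (0, 1]` with `p ≤ 1 − e^{−b}` such that the
independent long-range model with edge weights `1 − exp(−b(1_{{x,y} ∈ E(𝕃³)} + λ ‖x − y‖∞^{−(3+α)}))` does not percolate.

Proof: choose `p < p₁ < p₂ < p_c(ℤ³)`, `b = −log(1 − p₁)` (so `1 − e^{−b} = p₁ ≥ p`), and `λ ≤ 1` so small that the
nearest-neighbour weight `1 − e^{−b(1+λ)}` is `≤ p₂` and `b λ K χ(p₂) ≤ 1/2`, where `K = Σ_{v ≠ 0} ‖v‖∞^{−(3+α)} < ∞`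
(`summable_norm_rpow_neg`) and `χ(p₂) = Σ_v τ_{p₂}(0, v) < ∞` (`summable_tau_of_lt_criticalProb`, sharpness).  The long pairs
have weight `≤ b λ ‖y − x‖∞^{−(3+α)}` (`1 − e^{−t} ≤ t`), so the Aizenman–Newman cluster-of-clusters bound of
`…SubcritCatalystStabilityBounds` (`real_percolatesAt_eq_zero`: BK along long-edge chains, `χ_Q χ_T < 1`) gives
`P(|C(0)| = ∞) = 0`.  Continuity-free (every `p < p_c`).

Main result: `subcritCatalystStability_proof`.  No definitions, no sorries.
References: M. Aizenman, C. M. Newman, J. Stat. Phys. 36 (1984) §4 [AizenmanNewman1984]; G. Grimmett, *Percolation*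
(1999), §2.3, Thm (6.1) [GrimmettPercolation1999].
-/

noncomputable section

namespace Summit.CriticalPhenomena.PercolationContinuityZ3.Theorems

namespace SubcritCatalystStability

open MeasureTheory Finset Literature.Probability.LatticeModels Literature.Probability.Percolation
open scoped ENNReal

/-! ### The catalyst weights: nearest-neighbour value and long-pair bound -/

/-- Nearest neighbours of `ℤ³` are at sup-distance one. [folklore] -/
theorem dist_eq_one_of_adj {x y : Site 3} (h : (zdGraph 3).Adj x y) : dist x y = 1 := by
  rw [dist_eq_norm]
  obtain ⟨i, h | h⟩ := (zdGraph_adj_iff x y).1 h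
  · rw [h, sub_add_cancel_left, norm_neg, Pi.norm_single, norm_one]
  · rw [h, add_sub_cancel_left, Pi.norm_single, norm_one]

/-- On the nearest-neighbour edges the catalyst weight is the constant `1 − e^{−b(1+λ)}`. [folklore] -/
theorem catalyst_eq_of_mem_edgeSet (b l α : ℝ) (e : Sym2 (Site 3)) (he : e ∈ (zdGraph 3).edgeSet) :
    Set.projIcc (0:ℝ) 1 zero_le_one (1 - Real.exp (-(b * ((if e ∈ (zdGraph 3).edgeSet then (1:ℝ) else 0) +
        l * (Sym2.lift ⟨fun x y : Site 3 => (dist x y : ℝ), fun x y => dist_comm x y⟩ e) ^ (-(3 + α)))))) =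
      Set.projIcc (0:ℝ) 1 zero_le_one (1 - Real.exp (-(b * (1 + l)))) := by
  rw [if_pos he]
  induction e using Sym2.ind with
  | h x y =>
    have hd : (Sym2.lift ⟨fun x y : Site 3 => (dist x y : ℝ), fun x y => dist_comm x y⟩ s(x, y)) = 1 := by
      rw [Sym2.lift_mk]
      exact dist_eq_one_of_adj ((SimpleGraph.mem_edgeSet _).1 he)
    rw [hd, Real.one_rpow, mul_one]

/-- On the other pairs the catalyst weight is at most `b λ ‖y − x‖∞^{−(3+α)}` (`1 − e^{−t} ≤ t`). [folklore] -/
theorem catalyst_le_of_not_mem (b l α : ℝ) (hb : 0 ≤ b) (hl : 0 ≤ l) (x y : Site 3) (he : s(x, y) ∉ (zdGraph 3).edgeSet) :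
    ((Set.projIcc (0:ℝ) 1 zero_le_one (1 - Real.exp (-(b * ((if s(x, y) ∈ (zdGraph 3).edgeSet then (1:ℝ) else 0) +
        l * (Sym2.lift ⟨fun x y : Site 3 => (dist x y : ℝ), fun x y => dist_comm x y⟩ s(x, y)) ^ (-(3 + α))))))) : ℝ) ≤
      b * l * ‖y - x‖ ^ (-(3 + α)) := by
  rw [if_neg he, Sym2.lift_mk, Set.coe_projIcc, zero_add]
  change max 0 (min 1 (1 - Real.exp (-(b * (l * (dist x y : ℝ) ^ (-(3 + α))))))) ≤ _
  rw [dist_eq_norm, norm_sub_rev x y]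
  set t : ℝ := b * (l * ‖y - x‖ ^ (-(3 + α))) with ht
  have ht0 : 0 ≤ t := mul_nonneg hb (mul_nonneg hl (Real.rpow_nonneg (norm_nonneg _) _))
  have h1 : 1 - Real.exp (-t) ≤ t := by linarith [Real.add_one_le_exp (-t)]
  have h2 : 0 ≤ 1 - Real.exp (-t) := by
    have := Real.exp_le_one_iff.2 (neg_nonpos.2 ht0)
    linarith
  calc max 0 (min 1 (1 - Real.exp (-t))) ≤ max 0 (1 - Real.exp (-t)) := max_le_max le_rfl (min_le_right _ _)
    _ = 1 - Real.exp (-t) := max_eq_right h2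
    _ ≤ t := h1
    _ = b * l * ‖y - x‖ ^ (-(3 + α)) := by rw [ht]; ring

/-! ### The route statement -/

/-- **`PercLongRangeCatalyst.SubcritCatalystStability` (stmt-CriticalPhenomena-4824).**  For every `α > 0` and every
`p < p_c(ℤ³)` there are `b > 0` and `λ ∈ (0, 1]` with `p ≤ 1 − e^{−b}` such that the independent bond model on all pairs of
`ℤ³` with weights `1 − exp(−b(1_{{x,y} ∈ E(𝕃³)} + λ‖x − y‖∞^{−(3+α)}))` has `P(|C(0)| = ∞) = 0` — removal of the sparse
long-range catalyst is free below `p_c` (Aizenman–Newman cluster-of-clusters bound + BK + sharpness; no continuity input).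
[cite: AizenmanNewman1984, §4] -/
theorem subcritCatalystStability_proof :
    Summit.CriticalPhenomena.PercolationContinuityZ3.Theses.PercLongRangeCatalyst.SubcritCatalystStability := by
  intro α hα p hp
  set pc : ℝ := criticalProb (zdGraph 3) (0 : Site 3) with hpc
  have hpc1 : pc ≤ 1 := (criticalProb_mem_Icc (zdGraph 3) (0 : Site 3)).2
  have hpc0 : 0 < pc := lt_of_lt_of_le (by norm_num) (criticalProb_zd_ge_inv (d := 3) (by norm_num))
  have hp0 : 0 ≤ (p : ℝ) := p.2.1
  -- `p < p₁ < p₂ < p_c`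
  set p₁ : ℝ := (p + pc) / 2 with hp₁
  set p₂ : ℝ := (p₁ + pc) / 2 with hp₂
  have hp₁p : (p : ℝ) < p₁ := by rw [hp₁]; linarith
  have hp₁c : p₁ < pc := by rw [hp₁]; linarith
  have hp₁₂ : p₁ < p₂ := by rw [hp₂]; linarith
  have hp₂c : p₂ < pc := by rw [hp₂]; linarith
  have h1p₁ : 0 < 1 - p₁ := by linarith
  have h1p₂ : 0 < 1 - p₂ := by linarith
  -- `b = −log(1 − p₁)`, `B = −log(1 − p₂) > b`
  set b : ℝ := -Real.log (1 - p₁) with hb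
  set B : ℝ := -Real.log (1 - p₂) with hB
  have hb0 : 0 < b := by rw [hb, neg_pos]; exact Real.log_neg h1p₁ (by linarith)
  have hbB : b < B := by
    rw [hb, hB, neg_lt_neg_iff]
    exact Real.log_lt_log h1p₂ (by linarith)
  have hexpb : Real.exp (-b) = 1 - p₁ := by rw [hb, neg_neg, Real.exp_log h1p₁]
  have hexpB : Real.exp (-B) = 1 - p₂ := by rw [hB, neg_neg, Real.exp_log h1p₂]
  -- the two finite sums: `K = Σ ‖v‖^{−(3+α)}` and `χ₂ = Σ τ_{p₂}`
  have hKsum : Summable fun v : Site 3 => ‖v‖ ^ (-(3 + α)) :=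
    summable_norm_rpow_neg (d := 3) (by norm_num) (by push_cast; linarith)
  set K : ℝ := ∑' v : Site 3, ‖v‖ ^ (-(3 + α)) with hK
  have hK0 : 0 ≤ K := tsum_nonneg fun v => Real.rpow_nonneg (norm_nonneg _) _
  set q₂ : unitInterval := ⟨p₂, by linarith, by linarith⟩ with hq₂
  have hχsum : Summable fun v : Site 3 => tau 3 q₂ 0 v := summable_tau_of_lt_criticalProb (by norm_num) q₂ hp₂c
  set χ₂ : ℝ := ∑' v : Site 3, tau 3 q₂ 0 v with hχ₂
  have hχ0 : 0 ≤ χ₂ := tsum_nonneg fun v => tau_nonneg _ _ _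
  -- the choice of `λ`
  set l₁ : ℝ := B / b - 1 with hl₁
  have hl₁0 : 0 < l₁ := by rw [hl₁, sub_pos, lt_div_iff₀ hb0]; linarith
  set l : ℝ := min 1 (min l₁ (1 / (2 * (b * K * χ₂ + 1)))) with hl
  have hden : 0 < b * K * χ₂ + 1 := by positivity
  have hl0 : 0 < l := lt_min one_pos (lt_min hl₁0 (by positivity))
  have hl1 : l ≤ 1 := min_le_left _ _
  have hll₁ : l ≤ l₁ := (min_le_right _ _).trans (min_le_left _ _)
  have hl₃ : l ≤ 1 / (2 * (b * K * χ₂ + 1)) := (min_le_right _ _).trans (min_le_right _ _)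
  refine ⟨b, l, hb0, hl0, hl1, by rw [hexpb]; linarith, ?_⟩
  -- the nearest-neighbour weight `p' = 1 − e^{−b(1+λ)} ≤ p₂`
  set p' : unitInterval := Set.projIcc (0:ℝ) 1 zero_le_one (1 - Real.exp (-(b * (1 + l)))) with hp'
  have hp'le : p' ≤ q₂ := by
    rw [← Subtype.coe_le_coe, hp', Set.coe_projIcc]
    change max 0 (min 1 (1 - Real.exp (-(b * (1 + l))))) ≤ p₂
    have hbl : b * (1 + l) ≤ B := by
      have : 1 + l ≤ B / b := by rw [hl₁] at hll₁; linarith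
      calc b * (1 + l) ≤ b * (B / b) := mul_le_mul_of_nonneg_left this hb0.le
        _ = B := mul_div_cancel₀ B hb0.ne'
    have hexp : 1 - p₂ ≤ Real.exp (-(b * (1 + l))) := by rw [← hexpB]; exact Real.exp_le_exp.2 (by linarith)
    refine max_le (by linarith) ((min_le_right _ _).trans (by linarith))
  -- apply the cluster-of-clusters bound
  refine real_percolatesAt_eq_zero _ p' (fun v => b * l * ‖v‖ ^ (-(3 + α)))
    (fun e he => catalyst_eq_of_mem_edgeSet b l α e he)
    (fun x y _ he => catalyst_le_of_not_mem b l α hb0.le hl0.le x y he) ?_ ?_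
  · -- `χ_T ≤ χ(p₂) < ∞`
    refine ne_top_of_le_ne_top (ENNReal.ofReal_ne_top (r := χ₂)) ?_
    rw [hχ₂, ENNReal.ofReal_tsum_of_nonneg (fun v => tau_nonneg _ _ _) hχsum]
    exact ENNReal.tsum_le_tsum fun v => ENNReal.ofReal_le_ofReal (tau_mono_left hp'le _ _)
  · -- `χ_Q χ_T ≤ b λ K χ(p₂) ≤ 1/2 < 1`
    have hQ : ∑' v : Site 3, ENNReal.ofReal (b * l * ‖v‖ ^ (-(3 + α))) = ENNReal.ofReal (b * l * K) := by
      rw [hK, ← tsum_mul_left, ENNReal.ofReal_tsum_of_nonneg (fun v => by positivity) (hKsum.mul_left _)]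
    have hT : ∑' v : Site 3, ENNReal.ofReal (tau 3 p' 0 v) ≤ ENNReal.ofReal χ₂ := by
      rw [hχ₂, ENNReal.ofReal_tsum_of_nonneg (fun v => tau_nonneg _ _ _) hχsum]
      exact ENNReal.tsum_le_tsum fun v => ENNReal.ofReal_le_ofReal (tau_mono_left hp'le _ _)
    calc (∑' v : Site 3, ENNReal.ofReal (b * l * ‖v‖ ^ (-(3 + α)))) * ∑' v : Site 3, ENNReal.ofReal (tau 3 p' 0 v)
        ≤ ENNReal.ofReal (b * l * K) * ENNReal.ofReal χ₂ := by rw [hQ]; exact mul_le_mul_right hT _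
      _ = ENNReal.ofReal (b * l * K * χ₂) := by rw [← ENNReal.ofReal_mul (by positivity)]
      _ < 1 := by
          rw [← ENNReal.ofReal_one]
          refine (ENNReal.ofReal_lt_ofReal_iff one_pos).2 ?_
          have h1 : b * l * K * χ₂ = l * (b * K * χ₂) := by ring
          rw [h1]
          calc l * (b * K * χ₂) ≤ 1 / (2 * (b * K * χ₂ + 1)) * (b * K * χ₂) :=
                mul_le_mul_of_nonneg_right hl₃ (by positivity)
            _ < 1 := by
                rw [div_mul_eq_mul_div, div_lt_iff₀ (by positivity)]
                nlinarith

end SubcritCatalystStability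

end Summit.CriticalPhenomena.PercolationContinuityZ3.Theorems

end
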